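import Literature.NumberTheory.Transcendental.Waldschmidt1980Params
import HarnessLib

/-!
# Waldschmidt 1980, §3.2 over `ℚ` (`q = 2`): the unit `𝔘 = U/2ᵐ`, the bound `𝔅`, and the
lower-order terms

Support file (plain definitions and theorems; no named facts) for the archimedean input of the
Stewart–Yu 1991 line of `Literature.Barriers.ABC.stewartYu1991_upperBound` (M. Waldschmidt,
*A lower bound for linear forms in logarithms*, Acta Arith. **37** (1980), Prop. 3.8 over `ℚ`,
`q = 2`); sequel to `Waldschmidt1980Params.lean`.

All the sizes of the proof are measured in the unit `𝔘 = U/2ᵐ` (`m = d + 1`): the "moderate"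
quantities (numbers of unknowns, values of the `Δ`-polynomials, the factors `γⱼ^{τⱼ}`, Baker's
denominators `ν(x, h)^{τ₀}`) are `≤ 𝔅 = exp(𝔘/64)` each, the height factors are powers of
`E₁ = exp(S₀(∑ LⱼVⱼ + L_θ(V_θ+1)))` with `log E₁ ≤ 𝔘/4096`, while the extrapolation on `2ᵏ S₀`
points with `T/(2m·2ᴶ)` derivatives gains `exp(−¾ 2ᵏ 𝔘)`. This file proves the parameter
inequalities behind these statements (no data `αⱼ, bⱼ` yet):

* `𝔘`, `𝔅`, `U_eq`, `Wstar_le_𝔘`, … — the unit and the lower-order terms `W⋆, G, m ≤ 2⁻⁹⁸ 𝔘`;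
* `TWstar_le` (`T W⋆ ≤ 𝔘/c_T`), `log_U_le` (`log U ≤ 10 W⋆`), `S₀LV_le`
  (`S₀ (∑ⱼ LⱼVⱼ + L_θ V_θ) ≤ 𝔘/(2c_L')`), `hparLbG_le` (`h L_b G ≤ 𝔘/c_L + W⋆ + G`);
* `log_Xpt_div_le` — **`log((X + h)/h) ≤ 6 G`** for the largest evaluation point
  `X = 66 · 2^{d+1} L_θ S₀` of the `Δ`-polynomials: the reason for `h ≍ W⋆/G`.

## References

* [Waldschmidt1980] M. Waldschmidt, *A lower bound for linear forms in logarithms*, Acta Arith. 37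
  (1980), 257–283 — §3.2 (pp. 264–265), (3.7)–(3.14).
-/

noncomputable section

open Finset Real

namespace Literature.NumberTheory.Transcendental.Waldschmidt1980

namespace W80Par

variable {d : ℕ} (P : W80Par d)

/-! ### The unit and the bound -/

/-- The unit `𝔘 = U / 2ᵐ` (`m = d + 1`). [cite: Waldschmidt1980, §3.3 (3.19) (p. 269)] -/
def 𝔘 : ℝ := P.U / 2 ^ (d + 1)

/-- The common bound `𝔅 = exp(𝔘/64)` of the moderate quantities. [folklore] -/
def 𝔅 : ℝ := Real.exp (P.𝔘 / 64)

/-- `U = 2ᵐ 𝔘`. [folklore] -/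
theorem U_eq : P.U = 2 ^ (d + 1) * P.𝔘 := by
  unfold 𝔘; field_simp

/-- **`𝔘 ≥ 2^{49m} G (∏Vⱼ) V_θ W⋆`.** [folklore] -/
theorem 𝔘_ge : (2 : ℝ) ^ (49 * (d + 1)) * P.G * ((∏ j, P.V j) * P.Vθ) * P.Wstar ≤ P.𝔘 := P.U_div_ge

/-- `1 ≤ ∏ Vⱼ`. [folklore] -/
theorem one_le_prodV : (1 : ℝ) ≤ ∏ j, P.V j := by
  have : ∏ _j : Fin d, (1 : ℝ) ≤ ∏ j, P.V j := prod_le_prod (fun _ _ => zero_le_one) fun j _ => P.hV j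
  simpa using this

/-- `1 ≤ G`. [folklore] -/
theorem one_le_G : (1 : ℝ) ≤ P.G := by
  have := P.eleven_mR_le_G; have := two_le_mR P; nlinarith

/-- **`2⁹⁸ W⋆ ≤ 𝔘`** (`m ≥ 2`). [folklore] -/
theorem Wstar_le_𝔘 : (2 : ℝ) ^ 98 * P.Wstar ≤ P.𝔘 := by
  have h := P.𝔘_ge
  have hG := P.one_le_G; have hV := P.one_le_prodV; have hVθ := P.one_le_Vθ; have hW := P.one_le_Wstar
  have hd : 98 ≤ 49 * (d + 1) := by have := P.hd; omega
  calc (2 : ℝ) ^ 98 * P.Wstar ≤ 2 ^ (49 * (d + 1)) * P.Wstar := by gcongr; norm_num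
    _ = 2 ^ (49 * (d + 1)) * 1 * (1 * 1) * P.Wstar := by ring
    _ ≤ 2 ^ (49 * (d + 1)) * P.G * ((∏ j, P.V j) * P.Vθ) * P.Wstar := by gcongr
    _ ≤ P.𝔘 := h

/-- `2⁹⁸ G ≤ 𝔘`. [folklore] -/
theorem G_le_𝔘 : (2 : ℝ) ^ 98 * P.G ≤ P.𝔘 := by
  have h := P.𝔘_ge
  have hG := P.one_le_G; have hV := P.one_le_prodV; have hVθ := P.one_le_Vθ; have hW := P.one_le_Wstar
  have hd : 98 ≤ 49 * (d + 1) := by have := P.hd; omega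
  calc (2 : ℝ) ^ 98 * P.G ≤ 2 ^ (49 * (d + 1)) * P.G := by gcongr; norm_num
    _ = 2 ^ (49 * (d + 1)) * P.G * (1 * 1) * 1 := by ring
    _ ≤ 2 ^ (49 * (d + 1)) * P.G * ((∏ j, P.V j) * P.Vθ) * P.Wstar := by gcongr
    _ ≤ P.𝔘 := h

/-- `2⁹⁸ (∑Vⱼ + V_θ + 1)… `: the sizes are lower-order, `(∏Vⱼ) V_θ ≤ 2⁻⁹⁸ 𝔘`. [folklore] -/
theorem prodV_le_𝔘 : (2 : ℝ) ^ 98 * ((∏ j, P.V j) * P.Vθ) ≤ P.𝔘 := by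
  have h := P.𝔘_ge
  have hG := P.one_le_G; have hV := P.one_le_prodV; have hVθ := P.one_le_Vθ; have hW := P.one_le_Wstar
  have hd : 98 ≤ 49 * (d + 1) := by have := P.hd; omega
  have h0 : 0 ≤ (∏ j, P.V j) * P.Vθ := by positivity
  calc (2 : ℝ) ^ 98 * ((∏ j, P.V j) * P.Vθ) ≤ 2 ^ (49 * (d + 1)) * ((∏ j, P.V j) * P.Vθ) := by gcongr; norm_num
    _ = 2 ^ (49 * (d + 1)) * 1 * ((∏ j, P.V j) * P.Vθ) * 1 := by ring
    _ ≤ 2 ^ (49 * (d + 1)) * P.G * ((∏ j, P.V j) * P.Vθ) * P.Wstar := by gcongr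
    _ ≤ P.𝔘 := h

/-- `∑ Vⱼ + V_θ ≤ (d+1) · (∏Vⱼ) V_θ` (each size is at most the product of all). [folklore] -/
theorem sumV_le : (∑ j, P.V j) + P.Vθ ≤ (mR d) * ((∏ j, P.V j) * P.Vθ) := by
  have hVθ := P.one_le_Vθ
  have hVj : ∀ j, P.V j ≤ (∏ i, P.V i) * P.Vθ := by
    intro j
    have h1 : P.V j ≤ ∏ i, P.V i := by
      rw [← Finset.mul_prod_erase _ _ (mem_univ j)]
      have : 1 ≤ ∏ i ∈ (univ : Finset (Fin d)).erase j, P.V i := by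
        have : ∏ _i ∈ (univ : Finset (Fin d)).erase j, (1 : ℝ) ≤ ∏ i ∈ (univ : Finset (Fin d)).erase j, P.V i :=
          prod_le_prod (fun _ _ => zero_le_one) fun i _ => P.hV i
        simpa using this
      have h0 : 0 ≤ P.V j := le_trans zero_le_one (P.hV j)
      nlinarith
    have h0 : 0 ≤ ∏ i, P.V i := le_trans zero_le_one P.one_le_prodV
    nlinarith
  have hθ : P.Vθ ≤ (∏ i, P.V i) * P.Vθ := le_mul_of_one_le_left (by linarith) P.one_le_prodV
  calc (∑ j, P.V j) + P.Vθ ≤ (∑ _j : Fin d, (∏ i, P.V i) * P.Vθ) + (∏ i, P.V i) * P.Vθ :=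
        add_le_add (sum_le_sum fun j _ => hVj j) hθ
    _ = (mR d) * ((∏ j, P.V j) * P.Vθ) := by
        simp only [sum_const, card_univ, Fintype.card_fin, nsmul_eq_mul]; unfold mR; ring

/-- `m ≤ W⋆/9 ≤ 2⁻⁹⁸ 𝔘`. [folklore] -/
theorem mR_le_𝔘 : (2 : ℝ) ^ 98 * mR d ≤ P.𝔘 := by
  have h1 := P.nine_mR_le_Wstar; have h2 := P.Wstar_le_𝔘; have := mR_pos P
  nlinarith

/-- `∑Vⱼ + V_θ ≤ 2⁻⁹⁰ 𝔘`. [folklore] -/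
theorem sumV_le_𝔘 : (2 : ℝ) ^ 90 * ((∑ j, P.V j) + P.Vθ) ≤ P.𝔘 := by
  have h1 := P.sumV_le; have h2 := P.prodV_le_𝔘; have h3 := P.mR_le_𝔘
  have hm := mR_pos P
  have h0 : 0 ≤ (∏ j, P.V j) * P.Vθ := by have := P.one_le_prodV; have := P.one_le_Vθ; positivity
  -- `m · X ≤ (𝔘/2^98)(𝔘/2^98)`?? no: use `m X ≤ 2^{-98} 𝔘 · X`-free bound: `m ≤ 2^8` is false in general;
  -- instead `∑V + Vθ ≤ m X` and `m ≤ 𝔘/2^98`, `X ≤ 𝔘/2^98` would give a quadratic bound; we use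
  -- `𝔘 ≥ 2^{49m} X ≥ 2^{90} · 2^{8} m · X` for `m ≥ 2` (`2^{49m−98} ≥ m`).
  have h := P.𝔘_ge
  have hG := P.one_le_G; have hW := P.one_le_Wstar
  have hpow : (2 : ℝ) ^ 90 * mR d ≤ 2 ^ (49 * (d + 1)) := by
    have hm2 : mR d ≤ 2 ^ (d + 1) := by
      unfold mR
      have : ((d : ℝ) + 1) = ((d + 1 : ℕ) : ℝ) := by push_cast; ring
      rw [this]; exact_mod_cast (Nat.lt_two_pow_self).le
    have hd := P.hd
    calc (2 : ℝ) ^ 90 * mR d ≤ 2 ^ 90 * 2 ^ (d + 1) := by gcongr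
      _ = 2 ^ (91 + d) := by rw [← pow_add]; ring_nf
      _ ≤ 2 ^ (49 * (d + 1)) := pow_le_pow_right₀ (by norm_num) (by omega)
  calc (2 : ℝ) ^ 90 * ((∑ j, P.V j) + P.Vθ) ≤ 2 ^ 90 * ((mR d) * ((∏ j, P.V j) * P.Vθ)) := by gcongr
    _ = (2 ^ 90 * mR d) * ((∏ j, P.V j) * P.Vθ) := by ring
    _ ≤ 2 ^ (49 * (d + 1)) * ((∏ j, P.V j) * P.Vθ) := by gcongr
    _ = 2 ^ (49 * (d + 1)) * 1 * ((∏ j, P.V j) * P.Vθ) * 1 := by ring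
    _ ≤ 2 ^ (49 * (d + 1)) * P.G * ((∏ j, P.V j) * P.Vθ) * P.Wstar := by
        have h49 : (0 : ℝ) ≤ 2 ^ (49 * (d + 1)) := pow_nonneg zero_le_two _
        have hG0 : 0 ≤ P.G := by linarith
        exact mul_le_mul (mul_le_mul_of_nonneg_right (mul_le_mul_of_nonneg_left hG h49) h0) hW zero_le_one
          (mul_nonneg (mul_nonneg h49 hG0) h0)
    _ ≤ P.𝔘 := h

/-- `0 < 𝔘`, indeed `2⁹⁸ ≤ 𝔘`. [folklore] -/
theorem 𝔘_ge' : (2 : ℝ) ^ 98 ≤ P.𝔘 := by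
  have := P.Wstar_le_𝔘; have := P.one_le_Wstar; nlinarith

/-- `0 < 𝔘`. [folklore] -/
theorem 𝔘_pos : 0 < P.𝔘 := lt_of_lt_of_le (by norm_num) P.𝔘_ge'

/-- `1 ≤ 𝔅`. [folklore] -/
theorem one_le_𝔅 : 1 ≤ P.𝔅 := Real.one_le_exp (div_nonneg P.𝔘_pos.le (by norm_num))

/-- `0 < 𝔅`. [folklore] -/
theorem 𝔅_pos : 0 < P.𝔅 := Real.exp_pos _

/-- `exp y ≤ 𝔅` when `y ≤ 𝔘/64`. [folklore] -/
theorem exp_le_𝔅 {y : ℝ} (hy : y ≤ P.𝔘 / 64) : Real.exp y ≤ P.𝔅 := Real.exp_le_exp.mpr hy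

/-- `y ≤ 𝔅` when `log y ≤ 𝔘/64`. [folklore] -/
theorem le_𝔅_of_log_le {y : ℝ} (hy : Real.log y ≤ P.𝔘 / 64) : y ≤ P.𝔅 := by
  rcases le_or_gt y 0 with h | h
  · exact h.trans P.𝔅_pos.le
  · rw [← Real.exp_log h]; exact P.exp_le_𝔅 hy

/-! ### `T`, `S₀` against the unit -/

/-- **`T W⋆ ≤ 𝔘/c_T`.** [folklore] -/
theorem TWstar_le : (P.T : ℝ) * P.Wstar ≤ P.𝔘 / cT := by
  have h := P.T_le
  have hW := P.one_le_Wstar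
  unfold cT at *
  rw [P.U_eq] at h
  rw [le_div_iff₀ (by positivity)] at h
  rw [le_div_iff₀ (by norm_num)]
  have key : ((P.T : ℝ) * P.Wstar * 2 ^ 14) * 2 ^ (d + 1) ≤ P.𝔘 * 2 ^ (d + 1) := by
    calc ((P.T : ℝ) * P.Wstar * 2 ^ 14) * 2 ^ (d + 1) = P.T * (2 ^ 14 * 2 ^ (d + 1) * P.Wstar) := by ring
      _ ≤ 2 ^ (d + 1) * P.𝔘 := h
      _ = P.𝔘 * 2 ^ (d + 1) := by ring
  exact le_of_mul_le_mul_right key (by positivity)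

/-- `T ≤ 𝔘/c_T`. [folklore] -/
theorem T_le_𝔘 : (P.T : ℝ) ≤ P.𝔘 / cT := by
  have h := P.TWstar_le; have hW := P.one_le_Wstar
  have hT : (0 : ℝ) ≤ P.T := Nat.cast_nonneg _
  nlinarith

/-- `0 < T` (real). [folklore] -/
theorem T_pos : (0 : ℝ) < P.T := by have := P.one_le_T; exact_mod_cast this

/-- **`log U ≤ 10 W⋆`**: `U = Aᵐ m^{2m+1}/m! (∏V)V_θ W⋆ G` and each factor is `exp(O(W⋆))`
(`m log A ≤ 4W⋆`, `(2m+1) log m ≤ W⋆`, `∑ log Vⱼ + log V_θ ≤ W⋆`, `log W⋆ ≤ W⋆`, `log G ≤ 2W⋆`).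
[folklore] -/
theorem log_U_le : Real.log P.U ≤ 10 * P.Wstar := by
  have hW := P.one_le_Wstar; have hm := two_le_mR P; have hm0 := mR_pos P
  have hG := P.one_le_G; have hGW := P.G_le_two_Wstar
  have hVθ := P.one_le_Vθ; have hV := P.one_le_prodV
  have h9 := P.nine_mR_le_Wstar
  have hml := P.mlog_le_Wstar
  -- `U ≤ exp(10 W⋆)` multiplicatively
  apply (Real.log_le_iff_le_exp P.U_pos).mpr
  -- factor bounds
  have f1 : A ^ (d + 1) ≤ Real.exp (4 * P.Wstar) := by
    -- `A^m = 2^{50 m} ≤ e^{35 m} ≤ e^{4 W⋆}` since `9m ≤ W⋆`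
    unfold A
    have h2 : (2 : ℝ) ^ 50 ≤ Real.exp 35 := by
      have := Real.exp_one_gt_d9
      have h3 : (2.7182818283 : ℝ) ^ 35 ≤ Real.exp 1 ^ 35 := by gcongr
      rw [← Real.exp_nat_mul] at h3
      norm_num at h3 ⊢
      linarith
    calc ((2 : ℝ) ^ 50) ^ (d + 1) ≤ (Real.exp 35) ^ (d + 1) := by gcongr
      _ = Real.exp (35 * mR d) := by rw [← Real.exp_nat_mul]; unfold mR; push_cast; ring_nf
      _ ≤ Real.exp (4 * P.Wstar) := Real.exp_le_exp.mpr (by nlinarith)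
  have f2 : mR d ^ (2 * d + 3) / (d + 1).factorial ≤ Real.exp (P.Wstar) := by
    -- `m^{2m+1}/m! ≤ m^{m+1} e^{m}` (`m^m ≤ e^m m!`) and `(m+1) log m + m ≤ m (9 + log m) ≤ W⋆`
    have hfacpos : (0 : ℝ) < (d + 1).factorial := by exact_mod_cast Nat.factorial_pos _
    have hst := CW77.pow_self_le_exp_mul_factorial (d + 1)
    have em : ((d + 1 : ℕ) : ℝ) = mR d := by unfold mR; push_cast; ring
    rw [em] at hst
    have hlogm : 0 ≤ Real.log (mR d) := Real.log_nonneg (by linarith)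
    have hlog13 : Real.log (2 ^ 13 * mR d * P.Vθ) = Real.log (2 ^ 13 * P.Vθ) + Real.log (mR d) := by
      rw [show (2 : ℝ) ^ 13 * mR d * P.Vθ = (2 ^ 13 * P.Vθ) * mR d by ring, Real.log_mul (by positivity) hm0.ne']
    have h13 : 9 ≤ Real.log (2 ^ 13 * P.Vθ) := by
      have e9 : Real.exp 9 ≤ 2 ^ 13 * P.Vθ := by
        have := Real.exp_one_lt_d9
        calc Real.exp 9 = Real.exp 1 ^ 9 := by rw [← Real.exp_nat_mul]; norm_num
          _ ≤ (2.7182818286 : ℝ) ^ 9 := by gcongr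
          _ ≤ 2 ^ 13 * 1 := by norm_num
          _ ≤ 2 ^ 13 * P.Vθ := by gcongr
      calc (9 : ℝ) = Real.log (Real.exp 9) := (Real.log_exp 9).symm
        _ ≤ _ := Real.log_le_log (Real.exp_pos _) e9
    -- `m^{2d+3}/(d+1)! ≤ m^{d+2} e^{d+1}`
    have h1 : mR d ^ (2 * d + 3) / (d + 1).factorial ≤ mR d ^ (d + 2) * Real.exp 1 ^ (d + 1) := by
      rw [div_le_iff₀ hfacpos]
      calc mR d ^ (2 * d + 3) = mR d ^ (d + 2) * mR d ^ (d + 1) := by rw [← pow_add]; ring_nf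
        _ ≤ mR d ^ (d + 2) * (Real.exp 1 ^ (d + 1) * (d + 1).factorial) :=
            mul_le_mul_of_nonneg_left hst (by positivity)
        _ = mR d ^ (d + 2) * Real.exp 1 ^ (d + 1) * (d + 1).factorial := by ring
    refine h1.trans ?_
    have e1 : mR d ^ (d + 2) * Real.exp 1 ^ (d + 1) = Real.exp ((d + 2 : ℕ) * Real.log (mR d) + (d + 1 : ℕ)) := by
      rw [Real.exp_add, Real.exp_nat_mul, Real.exp_log hm0, ← Real.exp_nat_mul, mul_one]
    rw [e1]
    apply Real.exp_le_exp.mpr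
    have e2 : ((d + 2 : ℕ) : ℝ) = mR d + 1 := by unfold mR; push_cast; ring
    have e3 : ((d + 1 : ℕ) : ℝ) = mR d := em
    rw [e2, e3]
    have hlogm' : Real.log (mR d) ≤ mR d := (Real.log_le_sub_one_of_pos hm0).trans (by linarith)
    calc (mR d + 1) * Real.log (mR d) + mR d ≤ mR d * (9 + Real.log (mR d)) := by nlinarith
      _ ≤ mR d * Real.log (2 ^ 13 * mR d * P.Vθ) := by
          rw [hlog13]; exact mul_le_mul_of_nonneg_left (by linarith) hm0.le
      _ ≤ P.Wstar := hml
  have f3 : (∏ j, P.V j) * P.Vθ ≤ Real.exp P.Wstar := by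
    -- `Vⱼ ≤ Vθ`, so the product is `≤ Vθ^{d+1} = exp((d+1) log Vθ) ≤ exp(m log(2^13 m Vθ)) ≤ exp W⋆`
    have hVle : ∀ j, P.V j ≤ P.Vθ := fun j => (P.hVf j).trans P.hVfθ
    have h1 : (∏ j, P.V j) ≤ P.Vθ ^ d := by
      calc (∏ j, P.V j) ≤ ∏ _j : Fin d, P.Vθ := prod_le_prod (fun j _ => le_trans zero_le_one (P.hV j)) fun j _ => hVle j
        _ = P.Vθ ^ d := by rw [prod_const, card_univ, Fintype.card_fin]
    have hVθ0 : 0 < P.Vθ := by linarith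
    calc (∏ j, P.V j) * P.Vθ ≤ P.Vθ ^ d * P.Vθ := mul_le_mul_of_nonneg_right h1 hVθ0.le
      _ = P.Vθ ^ (d + 1) := by rw [pow_succ]
      _ = Real.exp ((d + 1 : ℕ) * Real.log P.Vθ) := by rw [Real.exp_nat_mul, Real.exp_log hVθ0]
      _ ≤ Real.exp P.Wstar := by
          apply Real.exp_le_exp.mpr
          have e : ((d + 1 : ℕ) : ℝ) = mR d := by unfold mR; push_cast; ring
          rw [e]
          have hlv : Real.log P.Vθ ≤ Real.log (2 ^ 13 * mR d * P.Vθ) := by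
            apply Real.log_le_log hVθ0
            have : (1 : ℝ) ≤ 2 ^ 13 * mR d := by nlinarith
            nlinarith
          have hlv0 : 0 ≤ Real.log P.Vθ := Real.log_nonneg hVθ
          calc mR d * Real.log P.Vθ ≤ mR d * Real.log (2 ^ 13 * mR d * P.Vθ) := mul_le_mul_of_nonneg_left hlv hm0.le
            _ ≤ P.Wstar := hml
  have f4 : P.Wstar ≤ Real.exp P.Wstar := by linarith [Real.add_one_le_exp P.Wstar]
  have f5 : P.G ≤ Real.exp (2 * P.Wstar) := by linarith [Real.add_one_le_exp (2 * P.Wstar)]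
  unfold U
  calc A ^ (d + 1) * (mR d ^ (2 * d + 3) / (d + 1).factorial) * ((∏ j, P.V j) * P.Vθ) * P.Wstar * P.G
      ≤ Real.exp (4 * P.Wstar) * Real.exp P.Wstar * Real.exp P.Wstar * Real.exp P.Wstar * Real.exp (2 * P.Wstar) := by
        have := P.U_pos
        have h0 : 0 ≤ mR d ^ (2 * d + 3) / (d + 1).factorial := by positivity
        have h00 : 0 ≤ (∏ j, P.V j) * P.Vθ := by positivity
        gcongr
    _ = Real.exp (9 * P.Wstar) := by simp only [← Real.exp_add]; ring_nf
    _ ≤ Real.exp (10 * P.Wstar) := Real.exp_le_exp.mpr (by linarith)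

/-- `log T ≤ 10 W⋆` (`T ≤ U`). [folklore] -/
theorem log_T_le : Real.log P.T ≤ 10 * P.Wstar := by
  have hT : (P.T : ℝ) ≤ P.U := by
    have h := P.T_le; have hW := P.one_le_Wstar; have hU := P.U_pos
    refine h.trans (div_le_self hU.le ?_)
    unfold cT
    have : (1 : ℝ) ≤ 2 ^ (d + 1) := one_le_pow₀ (by norm_num)
    nlinarith
  exact (Real.log_le_log P.T_pos hT).trans P.log_U_le

/-! ### The height exponents: `S₀ (∑ LⱼVⱼ + L_θ V_θ) ≤ 𝔘/(2 c_L')` -/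

/-- `S₀ Lⱼ Vⱼ ≤ 𝔘/(2 c_L' m)`. [folklore] -/
theorem S₀LV_le_one (j : Fin d) : (P.S₀ : ℝ) * (P.L j * P.V j) ≤ P.𝔘 / (2 * cL' * mR d) := by
  have hL : (P.L j : ℝ) ≤ P.U / (cL' * mR d * 2 ^ (d + 2) * P.S₀ * P.V j) := by
    unfold L
    exact Nat.floor_le (div_nonneg P.U_pos.le (by unfold cL'; have := mR_pos P; have := P.S₀_pos; have := P.hV j; positivity))
  have hS := P.S₀_pos; have hV := P.hV j; have hm := mR_pos P
  unfold cL' at *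
  rw [le_div_iff₀ (by positivity)] at hL
  rw [le_div_iff₀ (by positivity)]
  rw [P.U_eq] at hL
  have key : ((P.S₀ : ℝ) * (P.L j * P.V j) * (2 * 2 ^ 12 * mR d)) * 2 ^ (d + 1) ≤ P.𝔘 * 2 ^ (d + 1) := by
    calc ((P.S₀ : ℝ) * (P.L j * P.V j) * (2 * 2 ^ 12 * mR d)) * 2 ^ (d + 1)
        = P.L j * (2 ^ 12 * mR d * 2 ^ (d + 2) * P.S₀ * P.V j) := by rw [pow_succ]; ring
      _ ≤ 2 ^ (d + 1) * P.𝔘 := hL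
      _ = P.𝔘 * 2 ^ (d + 1) := by ring
  exact le_of_mul_le_mul_right key (by positivity)

/-- `S₀ L_θ V_θ ≤ 𝔘/(2 c_L' m)`. [folklore] -/
theorem S₀LθVθ_le : (P.S₀ : ℝ) * (P.Lθ * P.Vθ) ≤ P.𝔘 / (2 * cL' * mR d) := by
  have hL := P.Lθ_le
  have hS := P.S₀_pos; have hV := P.one_le_Vθ; have hm := mR_pos P
  unfold cL' at *
  rw [le_div_iff₀ (by positivity)] at hL
  rw [le_div_iff₀ (by positivity)]
  rw [P.U_eq] at hL
  have key : ((P.S₀ : ℝ) * (P.Lθ * P.Vθ) * (2 * 2 ^ 12 * mR d)) * 2 ^ (d + 1) ≤ P.𝔘 * 2 ^ (d + 1) := by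
    calc ((P.S₀ : ℝ) * (P.Lθ * P.Vθ) * (2 * 2 ^ 12 * mR d)) * 2 ^ (d + 1)
        = P.Lθ * (2 ^ 12 * mR d * 2 ^ (d + 2) * P.S₀ * P.Vθ) := by rw [pow_succ]; ring
      _ ≤ 2 ^ (d + 1) * P.𝔘 := hL
      _ = P.𝔘 * 2 ^ (d + 1) := by ring
  exact le_of_mul_le_mul_right key (by positivity)

/-- **`S₀ (∑ⱼ LⱼVⱼ + L_θ V_θ) ≤ 𝔘/(2 c_L')`** (`d + 1 = m` terms of size `𝔘/(2c_L' m)`).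
[cite: Waldschmidt1980, (3.11) (p. 265)] -/
theorem S₀LV_le : (P.S₀ : ℝ) * ((∑ j, P.L j * P.V j) + P.Lθ * P.Vθ) ≤ P.𝔘 / (2 * cL') := by
  have h1 : ∀ j, (P.S₀ : ℝ) * (P.L j * P.V j) ≤ P.𝔘 / (2 * cL' * mR d) := P.S₀LV_le_one
  have h2 := P.S₀LθVθ_le
  have hm := mR_pos P
  calc (P.S₀ : ℝ) * ((∑ j, P.L j * P.V j) + P.Lθ * P.Vθ)
      = (∑ j, (P.S₀ : ℝ) * (P.L j * P.V j)) + P.S₀ * (P.Lθ * P.Vθ) := by rw [mul_add, mul_sum]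
    _ ≤ (∑ _j : Fin d, P.𝔘 / (2 * cL' * mR d)) + P.𝔘 / (2 * cL' * mR d) := add_le_add (sum_le_sum fun j _ => h1 j) h2
    _ = (d + 1) * (P.𝔘 / (2 * cL' * mR d)) := by rw [sum_const, card_univ, Fintype.card_fin]; simp; ring
    _ = P.𝔘 / (2 * cL') := by unfold mR cL'; field_simp

/-- `L_θ S₀ ≤ 𝔘/2¹⁴` (`V_θ ≥ 1`, `m ≥ 2`, `c_L' = 2¹²`). [folklore] -/
theorem LθS₀_le : (P.Lθ : ℝ) * P.S₀ ≤ P.𝔘 / 2 ^ 14 := by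
  have h := P.S₀LθVθ_le
  have hV := P.one_le_Vθ; have hm := two_le_mR P; have hS := P.S₀_pos; have hU := P.𝔘_pos
  have hL : (0 : ℝ) ≤ P.Lθ := Nat.cast_nonneg _
  unfold cL' at h
  rw [le_div_iff₀ (by positivity)] at h
  rw [le_div_iff₀ (by positivity)]
  have h1 : (P.Lθ : ℝ) * P.S₀ * 1 ≤ P.Lθ * P.S₀ * P.Vθ := mul_le_mul_of_nonneg_left hV (by positivity)
  have h2 : (P.Lθ : ℝ) * P.S₀ * (2 ^ 14) ≤ P.S₀ * (P.Lθ * P.Vθ) * (2 * 2 ^ 12 * mR d) := by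
    calc (P.Lθ : ℝ) * P.S₀ * 2 ^ 14 = (P.Lθ * P.S₀ * 1) * (2 * 2 ^ 12 * 2) := by ring
      _ ≤ (P.Lθ * P.S₀ * P.Vθ) * (2 * 2 ^ 12 * mR d) := by gcongr
      _ = P.S₀ * (P.Lθ * P.Vθ) * (2 * 2 ^ 12 * mR d) := by ring
  linarith

/-! ### The `Δ`-polynomials: `h`, `L_b` -/

/-- `W⋆/G < h` (as reals). [folklore] -/
theorem Wstar_div_G_lt_hpar : P.Wstar / P.G < P.hpar := by
  unfold hpar; push_cast; exact Nat.lt_floor_add_one _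

/-- `1 ≤ h`. [folklore] -/
theorem one_le_hpar : 1 ≤ P.hpar := Nat.le_add_left 1 _

/-- `0 < h` (real). [folklore] -/
theorem hpar_pos : (0 : ℝ) < P.hpar := by have := P.one_le_hpar; exact_mod_cast this

/-- `h G ≤ W⋆ + G`. [folklore] -/
theorem hparG_le : (P.hpar : ℝ) * P.G ≤ P.Wstar + P.G := by
  unfold hpar; push_cast
  have hG := P.G_pos
  have h1 : (⌊P.Wstar / P.G⌋₊ : ℝ) ≤ P.Wstar / P.G := Nat.floor_le (div_nonneg (by linarith [P.one_le_Wstar]) hG.le)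
  have : (⌊P.Wstar / P.G⌋₊ : ℝ) * P.G ≤ P.Wstar := by rwa [le_div_iff₀ hG] at h1
  nlinarith

/-- `h ≤ 3 W⋆` (and so `h` is lower-order). [folklore] -/
theorem hpar_le : (P.hpar : ℝ) ≤ 3 * P.Wstar := by
  have h := P.hparG_le; have hG := P.one_le_G; have hGW := P.G_le_two_Wstar; have h0 := P.hpar_pos
  nlinarith

/-- `1 ≤ L_b`. [folklore] -/
theorem one_le_Lb : 1 ≤ P.Lb := Nat.le_add_left 1 _

/-- `h L_b G ≤ 𝔘/c_L + h G`, i.e. **`h L_b G ≤ 𝔘/c_L + W⋆ + G`**. [folklore] -/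
theorem hparLbG_le : (P.hpar : ℝ) * P.Lb * P.G ≤ P.𝔘 / cL + (P.Wstar + P.G) := by
  have hh := P.hpar_pos; have hG := P.G_pos; have hU := P.U_pos
  have hLb : (P.Lb : ℝ) ≤ P.U / (cL * 2 ^ (d + 1) * P.G * P.hpar) + 1 := by
    unfold Lb; push_cast
    have := Nat.floor_le (show 0 ≤ P.U / (cL * 2 ^ (d + 1) * P.G * P.hpar) by unfold cL; positivity)
    linarith
  have e : P.U / (cL * 2 ^ (d + 1) * P.G * P.hpar) = P.𝔘 / cL / (P.G * P.hpar) := by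
    rw [P.U_eq]; unfold cL; field_simp
  rw [e] at hLb
  have h2 := P.hparG_le
  calc (P.hpar : ℝ) * P.Lb * P.G ≤ P.hpar * (P.𝔘 / cL / (P.G * P.hpar) + 1) * P.G := by gcongr
    _ = P.𝔘 / cL + P.hpar * P.G := by field_simp
    _ ≤ P.𝔘 / cL + (P.Wstar + P.G) := by linarith

/-- `h L_b ≤ 𝔘/c_L + 3W⋆` (`G ≥ 1`). [folklore] -/
theorem hparLb_le : (P.hpar : ℝ) * P.Lb ≤ P.𝔘 / cL + 3 * P.Wstar := by
  have h := P.hparLbG_le; have hG := P.one_le_G; have hGW := P.G_le_two_Wstar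
  have h0 : 0 ≤ (P.hpar : ℝ) * P.Lb := by positivity
  have hU : 0 ≤ P.𝔘 / cL := by unfold cL; have := P.𝔘_pos; positivity
  nlinarith

/-! ### The largest evaluation point against `h`: `log((X+h)/h) ≤ 6G` -/

/-- The largest (scaled) evaluation point of the `Δ`-polynomials: `X = 66 · 2^{d+1} L_θ S₀`
(`|z| ≤ 65 · SK ≤ 65 · 2^{d+J} S₀` at scale `2^{J₀−J} ≤ 2^{J₀} ≤ 2L_θ`). [folklore] -/
def Xpt : ℝ := 66 * 2 ^ (d + 1) * P.Lθ * P.S₀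

/-- `0 ≤ X`. [folklore] -/
theorem Xpt_nonneg : 0 ≤ P.Xpt := by unfold Xpt; positivity

/-- `X ≤ 33 U/(c_L' m V_θ)`. [folklore] -/
theorem Xpt_le : P.Xpt ≤ 33 * P.U / (cL' * mR d * P.Vθ) := by
  have hL := P.Lθ_le
  have hS := P.S₀_pos; have hV := P.one_le_Vθ; have hm := mR_pos P; have hU := P.U_pos
  unfold Xpt cL' at *
  rw [le_div_iff₀ (by positivity)] at hL
  rw [le_div_iff₀ (by positivity)]
  have e : (2 : ℝ) ^ (d + 2) = 2 * 2 ^ (d + 1) := by rw [pow_succ]; ring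
  rw [e] at hL
  have h2 : (0 : ℝ) < 2 ^ (d + 1) := by positivity
  nlinarith [mul_le_mul_of_nonneg_left hL h2.le]

/-- `Aᵐ m^{2m+1} ≤ e^{3G}`: `35m + 3m log m ≤ 3m(17 log 2 + log m) ≤ 3G`. [folklore] -/
theorem A_pow_mul_le : A ^ (d + 1) * mR d ^ (2 * d + 3) ≤ Real.exp (3 * P.G) := by
  have hm := two_le_mR P; have hm0 := mR_pos P; have hVf := P.hVf1
  have hlogm : 0 ≤ Real.log (mR d) := Real.log_nonneg (by linarith)
  have h2 : (2 : ℝ) ^ 50 ≤ Real.exp 35 := by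
    have := Real.exp_one_gt_d9
    have h3 : (2.7182818283 : ℝ) ^ 35 ≤ Real.exp 1 ^ 35 := by gcongr
    rw [← Real.exp_nat_mul] at h3
    norm_num at h3 ⊢
    linarith
  have f1 : A ^ (d + 1) ≤ Real.exp (35 * mR d) := by
    unfold A
    calc ((2 : ℝ) ^ 50) ^ (d + 1) ≤ (Real.exp 35) ^ (d + 1) := by gcongr
      _ = Real.exp (35 * mR d) := by rw [← Real.exp_nat_mul]; unfold mR; push_cast; ring_nf
  have f2 : mR d ^ (2 * d + 3) ≤ Real.exp (3 * mR d * Real.log (mR d)) := by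
    calc mR d ^ (2 * d + 3) = Real.exp ((2 * d + 3 : ℕ) * Real.log (mR d)) := by
          rw [Real.exp_nat_mul, Real.exp_log hm0]
      _ ≤ Real.exp (3 * mR d * Real.log (mR d)) := by
          apply Real.exp_le_exp.mpr
          have e : ((2 * d + 3 : ℕ) : ℝ) = 2 * mR d + 1 := by unfold mR; push_cast; ring
          rw [e]; nlinarith
  have hG : 35 * mR d + 3 * mR d * Real.log (mR d) ≤ 3 * P.G := by
    unfold G
    have hlog : Real.log (2 ^ 17 * mR d * P.Vf) = 17 * Real.log 2 + Real.log (mR d) + Real.log P.Vf := by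
      rw [Real.log_mul (by positivity) (by linarith), Real.log_mul (by positivity) hm0.ne', Real.log_pow]; push_cast; ring
    rw [hlog]
    have hl2 := Real.log_two_gt_d9
    have hlVf : 0 ≤ Real.log P.Vf := Real.log_nonneg hVf
    nlinarith
  calc A ^ (d + 1) * mR d ^ (2 * d + 3) ≤ Real.exp (35 * mR d) * Real.exp (3 * mR d * Real.log (mR d)) := by
        have : (0 : ℝ) ≤ A ^ (d + 1) := by unfold A; positivity
        gcongr
    _ = Real.exp (35 * mR d + 3 * mR d * Real.log (mR d)) := by rw [← Real.exp_add]
    _ ≤ Real.exp (3 * P.G) := Real.exp_le_exp.mpr hG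

/-- `∏ Vⱼ ≤ e^{G}` (`d log V_f ≤ m log(2¹⁷ m V_f)`). [folklore] -/
theorem prodV_le_exp_G : (∏ j, P.V j) ≤ Real.exp P.G := by
  have hm := two_le_mR P; have hm0 := mR_pos P; have hVf := P.hVf1
  have h1 : (∏ j, P.V j) ≤ P.Vf ^ d := by
    calc (∏ j, P.V j) ≤ ∏ _j : Fin d, P.Vf := prod_le_prod (fun j _ => le_trans zero_le_one (P.hV j)) fun j _ => P.hVf j
      _ = P.Vf ^ d := by rw [prod_const, card_univ, Fintype.card_fin]
  refine h1.trans ?_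
  have hVf0 : 0 < P.Vf := by linarith
  rw [← Real.exp_log hVf0, ← Real.exp_nat_mul, Real.exp_le_exp]
  unfold G
  have hlv : Real.log P.Vf ≤ Real.log (2 ^ 17 * mR d * P.Vf) := by
    apply Real.log_le_log hVf0
    have : (1 : ℝ) ≤ 2 ^ 17 * mR d := by nlinarith
    nlinarith
  have hlv0 : 0 ≤ Real.log P.Vf := Real.log_nonneg hVf
  have hd : (d : ℝ) ≤ mR d := by unfold mR; linarith
  calc (d : ℝ) * Real.log P.Vf ≤ mR d * Real.log P.Vf := mul_le_mul_of_nonneg_right hd hlv0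
    _ ≤ mR d * Real.log (2 ^ 17 * mR d * P.Vf) := mul_le_mul_of_nonneg_left hlv hm0.le

/-- `G² ≤ e^{G}` (`e^{G/2} ≥ 1 + G/2 + G²/8 ≥ G`). [folklore] -/
theorem G_sq_le_exp_G : P.G ^ 2 ≤ Real.exp P.G := by
  have hG := P.G_pos
  have h := Real.quadratic_le_exp_of_nonneg (show 0 ≤ P.G / 2 by positivity)
  have h1 : P.G ≤ Real.exp (P.G / 2) := by nlinarith
  calc P.G ^ 2 ≤ Real.exp (P.G / 2) ^ 2 := pow_le_pow_left₀ hG.le h1 2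
    _ = Real.exp P.G := by rw [← Real.exp_nat_mul]; ring_nf

/-- **`X/h + 1 ≤ e^{6G}`**: with `h > W⋆/G`,
`X/h ≤ 33 U G/(c_L' m V_θ W⋆) = 33 Aᵐ (m^{2m+1}/m!) (∏Vⱼ) G²/(c_L' m) ≤ e^{3G} e^{G} e^{G}`.
[folklore] -/
theorem Xpt_div_hpar_le : P.Xpt / P.hpar + 1 ≤ Real.exp (6 * P.G) := by
  have hh := P.hpar_pos; have hG := P.G_pos; have hW := P.one_le_Wstar; have hm := two_le_mR P
  have hm0 := mR_pos P; have hVf := P.hVf1; have hVθ := P.one_le_Vθ; have hV1 := P.one_le_prodV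
  -- Step 1: `X/h ≤ X G / W⋆`
  have h1 : P.Xpt / P.hpar ≤ P.Xpt * P.G / P.Wstar := by
    rw [div_le_div_iff₀ hh (by linarith)]
    have := P.Wstar_div_G_lt_hpar
    rw [div_lt_iff₀ hG] at this
    have hX := P.Xpt_nonneg
    nlinarith
  -- Step 2: `X G/W⋆ ≤ A^m m^{2m+1} (∏V) G²`
  have h2 : P.Xpt * P.G / P.Wstar ≤ A ^ (d + 1) * mR d ^ (2 * d + 3) * (∏ j, P.V j) * P.G ^ 2 := by
    have hX := P.Xpt_le
    rw [div_le_iff₀ (by linarith)]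
    have hfac : (1 : ℝ) ≤ (d + 1).factorial := by exact_mod_cast Nat.one_le_iff_ne_zero.mpr (Nat.factorial_ne_zero _)
    have hUeq : P.U = A ^ (d + 1) * (mR d ^ (2 * d + 3) / (d + 1).factorial) * ((∏ j, P.V j) * P.Vθ) * P.Wstar * P.G := rfl
    unfold cL' at hX
    rw [le_div_iff₀ (by positivity)] at hX
    have hA : (0 : ℝ) ≤ A ^ (d + 1) := by unfold A; positivity
    have key : P.Xpt * (2 ^ 12 * mR d * P.Vθ) * P.G ≤ 33 * (A ^ (d + 1) * mR d ^ (2 * d + 3) * (∏ j, P.V j) * P.G ^ 2 * P.Wstar * P.Vθ) := by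
      have hdiv : mR d ^ (2 * d + 3) / (d + 1).factorial ≤ mR d ^ (2 * d + 3) := div_le_self (by positivity) hfac
      calc P.Xpt * (2 ^ 12 * mR d * P.Vθ) * P.G ≤ 33 * P.U * P.G := by nlinarith
        _ = 33 * (A ^ (d + 1) * (mR d ^ (2 * d + 3) / (d + 1).factorial) * (∏ j, P.V j) * P.G ^ 2 * P.Wstar * P.Vθ) := by
            rw [hUeq]; ring
        _ ≤ 33 * (A ^ (d + 1) * mR d ^ (2 * d + 3) * (∏ j, P.V j) * P.G ^ 2 * P.Wstar * P.Vθ) := by gcongr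
    have h33 : 33 * P.Vθ ≤ 2 ^ 12 * mR d * P.Vθ := by nlinarith
    have hZ : 0 ≤ A ^ (d + 1) * mR d ^ (2 * d + 3) * (∏ j, P.V j) * P.G ^ 2 * P.Wstar := by positivity
    nlinarith [mul_le_mul_of_nonneg_left h33 (mul_nonneg hZ P.G_pos.le), P.Xpt_nonneg]
  -- Step 3: the exponential bounds
  have f1 := P.A_pow_mul_le
  have f3 := P.prodV_le_exp_G
  have f4 := P.G_sq_le_exp_G
  have h3 : A ^ (d + 1) * mR d ^ (2 * d + 3) * (∏ j, P.V j) * P.G ^ 2 ≤ Real.exp (5 * P.G) := by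
    calc A ^ (d + 1) * mR d ^ (2 * d + 3) * (∏ j, P.V j) * P.G ^ 2
        = (A ^ (d + 1) * mR d ^ (2 * d + 3)) * (∏ j, P.V j) * P.G ^ 2 := by ring
      _ ≤ Real.exp (3 * P.G) * Real.exp P.G * Real.exp P.G := by
          have : (0 : ℝ) ≤ A ^ (d + 1) * mR d ^ (2 * d + 3) := by unfold A; positivity
          gcongr
      _ = Real.exp (5 * P.G) := by simp only [← Real.exp_add]; ring_nf
  have h4 : Real.exp (5 * P.G) + 1 ≤ Real.exp (6 * P.G) := by
    have hG1 := P.one_le_G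
    have e : Real.exp (6 * P.G) = Real.exp (5 * P.G) * Real.exp P.G := by rw [← Real.exp_add]; ring_nf
    rw [e]
    have h2e : 2 ≤ Real.exp P.G := by
      have := Real.add_one_le_exp P.G; linarith
    have h5 : 1 ≤ Real.exp (5 * P.G) := Real.one_le_exp (by positivity)
    nlinarith
  linarith [h1, h2, h3, h4]

/-- **`log((X + h)/h) ≤ 6 G`.** [cite: Waldschmidt1980, (3.13)–(3.14) (p. 265)] -/
theorem log_Xpt_div_le : Real.log ((P.Xpt + P.hpar) / P.hpar) ≤ 6 * P.G := by
  have hh := P.hpar_pos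
  have e : (P.Xpt + P.hpar) / P.hpar = P.Xpt / P.hpar + 1 := by field_simp
  rw [e]
  have h := P.Xpt_div_hpar_le
  have hpos : 0 < P.Xpt / P.hpar + 1 := by have := P.Xpt_nonneg; positivity
  calc Real.log (P.Xpt / P.hpar + 1) ≤ Real.log (Real.exp (6 * P.G)) := Real.log_le_log hpos h
    _ = 6 * P.G := Real.log_exp _

end W80Par

end Literature.NumberTheory.Transcendental.Waldschmidt1980

end
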